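import Literature.AlgebraicGeometry.Resolution.StrictTransformTargetLocality
import HarnessLib

/-!
# The strict transform is local on the base

Topic: `Literature/AlgebraicGeometry/Resolution`. For `f : X → S`, `b : S' → S` with
`b⁻¹𝓘 𝒪_{S'}` an effective Cartier divisor, and an open immersion `i : S₀ → S`, the strict
transform of the base change `X ×_S S₀ → S₀` along the base change `S' ×_S S₀ → S₀` (with respect
to `𝓘|_{S₀}`) is the strict transform of `X` along `S' ×_S S₀ → S' → S`, i.e.
(`StrictTransformTargetLocality.lean`) the open piece of the strict transform `X' → S'` lying
over `S' ×_S S₀ ⊆ S'`. Consequently a property of morphisms which is Zariski-local on the target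
holds for `X' → S'` as soon as it holds for the strict transforms of the restrictions
`X_{Sₖ} → Sₖ` of `f` to the members of an open cover of `S` — the reduction "we may assume `S`
affine".

* `blowupStrictTransformMap_iff_of_iso` — transport of the strict transform along an
  isomorphism of the total space `X ×_S S'` over `S'` preserving the dense open;
* `baseChangeIso` — `(X ×_S S₀) ×_{S₀} (S' ×_S S₀) ≅ X ×_S (S' ×_S S₀)` with its compatibilities;
* `blowupStrictTransformMap_baseChange_iff` — the strict transform of the base-changed
  situation is the strict transform along `S' ×_S S₀ → S`;
* `blowupStrictTransformMap_of_openCover_base` — **`P` local on the target holds for `X' → S'`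
  if it holds for the strict transforms of `X ×_S Sₖ → Sₖ`, `(Sₖ)` an open cover of `S`.**

## References

* The Stacks Project, Tag 080C ("The question is local on `S`"), Tag 081R (proof: "we may
  assume `S` affine"). [StacksProject]
-/

noncomputable section

open CategoryTheory CategoryTheory.Limits AlgebraicGeometry TopologicalSpace

namespace Literature.AlgebraicGeometry.Resolution

universe u

/-! ## Transport along an isomorphism of the total space -/

section Iso

variable {T₁ T₂ S' : Scheme.{u}} (e : T₂ ⟶ T₁) [IsIso e] (s₁ : T₁ ⟶ S') (s₂ : T₂ ⟶ S')
  (O₁ : T₁.Opens) (O₂ : T₂.Opens)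

/-- **Transport of scheme-theoretic closures along an isomorphism**: for an isomorphism
`e : T₂ ≅ T₁` over `S'` carrying a quasi-compact open `O₂` onto `O₁`, a property of morphisms
respecting isomorphisms holds for `closure(O₁) → S'` iff it holds for `closure(O₂) → S'`.
[folklore] -/
theorem subschemeι_ker_ι_comp_iff_of_iso (P : MorphismProperty Scheme.{u}) [P.RespectsIso]
    [QuasiCompact O₁.ι] (hs : e ≫ s₁ = s₂) (hO : O₂ = e ⁻¹ᵁ O₁) :
    P (O₁.ι.ker.subschemeι ≫ s₁) ↔ P (O₂.ι.ker.subschemeι ≫ s₂) := by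
  have hK : O₂.ι.ker = O₁.ι.ker.comap e := ker_ι_preimage_eq_comap e O₁ O₂ hO
  -- `V(K₁|T₂) → T₂ ≅ T₁` is `V(K₁) ×_{T₁} T₂ → V(K₁)` followed by `V(K₁) → T₁`
  have hfac : (O₁.ι.ker.comap e).subschemeι ≫ e =
      ((O₁.ι.ker.comapIso e).hom ≫ pullback.snd e O₁.ι.ker.subschemeι) ≫ O₁.ι.ker.subschemeι := by
    rw [Category.assoc, ← pullback.condition, ← Category.assoc,
      Scheme.IdealSheafData.comapIso_hom_fst]
  rw [hK, ← hs, ← Category.assoc, hfac]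
  simp only [Category.assoc]
  rw [P.cancel_left_of_respectsIso (O₁.ι.ker.comapIso e).hom,
    P.cancel_left_of_respectsIso (pullback.snd e O₁.ι.ker.subschemeι)]

end Iso

/-! ## Base change along an open immersion of the base -/

section BaseChange

variable {X S S' S₀ : Scheme.{u}} (f : X ⟶ S) (b : S' ⟶ S) (I : S.IdealSheafData) (i : S₀ ⟶ S)

/-- `(X ×_S S₀) ×_{S₀} (S' ×_S S₀) ⟶ X ×_S (S' ×_S S₀)` (over `S' ×_S S₀`), an isomorphism:
pasting of pullbacks and `S' ×_S S₀ → S₀ → S = S' ×_S S₀ → S' → S`. [folklore] -/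
def strictTransformBaseChangeHom : pullback (pullback.snd f i) (pullback.snd b i) ⟶
    pullback f (pullback.fst b i ≫ b) :=
  (pullbackLeftPullbackSndIso f i (pullback.snd b i)).hom ≫
    (pullback.congrHom rfl (pullback.condition (f := b) (g := i)).symm).hom

/-- `strictTransformBaseChangeHom` is an isomorphism. [folklore] -/
instance isIso_strictTransformBaseChangeHom : IsIso (strictTransformBaseChangeHom f b i) := by
  unfold strictTransformBaseChangeHom
  infer_instance

/-- `strictTransformBaseChangeHom` is a morphism over `S' ×_S S₀`. [folklore] -/
@[reassoc]
theorem strictTransformBaseChangeHom_snd : strictTransformBaseChangeHom f b i ≫ pullback.snd f (pullback.fst b i ≫ b) =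
    pullback.snd (pullback.snd f i) (pullback.snd b i) := by
  rw [strictTransformBaseChangeHom, Category.assoc, pullback.congrHom_hom]
  simp only [pullback.map, pullback.lift_snd, Category.comp_id]
  exact pullbackLeftPullbackSndIso_hom_snd _ _ _

/-- **The strict transform of the base-changed situation is the strict transform along
`S' ×_S S₀ → S' → S`**: for a property of morphisms respecting isomorphisms (`b⁻¹𝓘 𝒪_{S'}`
an effective Cartier divisor), `P` holds for the strict transform of `X ×_S S₀ → S₀` along
`S' ×_S S₀ → S₀` with respect to `𝓘|_{S₀}` iff it holds for the strict transform of `X → S`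
along `S' ×_S S₀ → S`. [cite: StacksProject, Tag 080C] -/
theorem blowupStrictTransformMap_baseChange_iff [IsOpenImmersion i] (P : MorphismProperty Scheme.{u})
    [P.RespectsIso] (hE : IsEffectiveCartier (I.comap b)) :
    P (blowupStrictTransformMap (pullback.snd f i) (pullback.snd b i) (I.comap i)) ↔
      P (blowupStrictTransformMap f (pullback.fst b i ≫ b) I) := by
  haveI : QuasiCompact ((pullback.snd f (pullback.fst b i ≫ b)) ⁻¹ᵁ
      ((pullback.fst b i ≫ b) ⁻¹ᵁ centreCompl I)).ι := by
    rw [preimage_centreCompl, Scheme.IdealSheafData.comap_comp]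
    exact quasiCompact_ι_preimage_centreCompl _ (hE.comap_of_isOpenImmersion _)
  symm
  refine subschemeι_ker_ι_comp_iff_of_iso (strictTransformBaseChangeHom f b i) _ _ _ _ P
    (strictTransformBaseChangeHom_snd f b i) ?_
  -- the dense opens correspond
  have hm : pullback.snd (pullback.snd f i) (pullback.snd b i) ≫ pullback.snd b i ≫ i =
      strictTransformBaseChangeHom f b i ≫ pullback.snd f (pullback.fst b i ≫ b) ≫ pullback.fst b i ≫ b := by
    rw [strictTransformBaseChangeHom_snd_assoc, pullback.condition]
  rw [← preimage_centreCompl i I]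
  show (pullback.snd (pullback.snd f i) (pullback.snd b i) ≫ pullback.snd b i ≫ i) ⁻¹ᵁ centreCompl I =
    (strictTransformBaseChangeHom f b i ≫ pullback.snd f (pullback.fst b i ≫ b) ≫ pullback.fst b i ≫ b) ⁻¹ᵁ
      centreCompl I
  rw [hm]

end BaseChange

/-- **A property of morphisms which is Zariski-local on the target holds for the strict
transform `X' → S'` as soon as it holds for the strict transforms of the restrictions
`X ×_S Sₖ → Sₖ` along `S' ×_S Sₖ → Sₖ`, for an open cover `(Sₖ)` of the base `S`** (`b⁻¹𝓘 𝒪_{S'}`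
an effective Cartier divisor): "we may assume `S` affine". [cite: StacksProject, Tag 081R (proof)] -/
theorem blowupStrictTransformMap_of_openCover_base {X S S' : Scheme.{u}} (f : X ⟶ S) (b : S' ⟶ S)
    (I : S.IdealSheafData) (P : MorphismProperty Scheme.{u}) [IsZariskiLocalAtTarget P]
    (hE : IsEffectiveCartier (I.comap b)) (𝒱 : S.OpenCover)
    (H : ∀ k, P (blowupStrictTransformMap (pullback.snd f (𝒱.f k)) (pullback.snd b (𝒱.f k))
      (I.comap (𝒱.f k)))) :
    P (blowupStrictTransformMap f b I) :=
  blowupStrictTransformMap_of_openCover_target f b I P hE (𝒱.pullback₁ b) fun k =>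
    (blowupStrictTransformMap_baseChange_iff f b I (𝒱.f k) P hE).mp (H k)

end Literature.AlgebraicGeometry.Resolution

end
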